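import Summits.BirchSwinnertonDyer.Rank1Residual.Additive.CongruentLambdaShiftOfEPW
import Literature.NumberTheory.EllipticCurves.Greenberg1999.SelmerCorankLambdaParity
import Literature.NumberTheory.EllipticCurves.BSDRankResidualCellsProofs
import Literature.NumberTheory.EllipticCurves.BSDSelmerPConverse
import HarnessLib

/-!
# PARITY TRANSPORT along a congruence at an ADDITIVE potentially-ordinary prime: the parity of
# `corank_{ℤ_p} Sel_{p^∞}(E/ℚ) + Σ_{v∈Σ₀} δ(E,v)` is a congruence invariant on the ramified ordinary
# branch (EPW 2006 Thm. 3.3.3 + Greenberg 1999 Prop. 3.10 — both EXISTING tree facts)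
# (cell `b2b-bsdres`, lane CLASS-CLOSURE, seat cc-typer-1 gen 5 = typer of record N11 / O8; payload (c) "congruence")

HONEST FRAMING (cell `b2b-bsdres`, run/shared/lean/b2b/bsd-rank1-residual/, verbatim in every
file): the goal of the cell is to DELETE the COMBINATION-SHAPED residual classes of the
Birch–Swinnerton-Dyer formula for ALL analytic-rank `≤ 1` elliptic curves over `ℚ` — "full BSD
formula for every rank `≤ 1` curve in class `C`" assembled STRICTLY from published theorems — so
that the rank-`≤ 1` remainder becomes exactly the CONSTRUCTION-SHAPED classes, which are TYPED
(missing-input `Prop`s), NOT attempted. This is not "finishing BSD". Lane CLASS-CLOSURE: research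
routes, no claim beyond the stated classes; census output = EVIDENCE, never a Literature fact;
NOTHING is booked here. THEOREMS ONLY (no definition, no named fact, no conjecture node): the two
published inputs are the EXISTING named facts
`EmertonPollackWeston2006.muLambdaAlg_transfer_of_torsionIso_potOrd` (hypothesis `hEPW`; EPW 2006
Thms. 3.3.2 / 3.3.3 (2) / Lemma 5.1.5 on the ramified branch, file
`Literature/…/EmertonPollackWeston2006/NearlyOrdinaryAlgebraicTransfer.lean`, as re-landed with the
`C ≠ 0` clause p255913) and `Greenberg1999.prop310_selmerCorank_mod_two_eq_lambdaInvariant`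
(hypothesis `h310`; Greenberg LNM 1716 Prop. 3.10, `Literature/…/Greenberg1999/SelmerCorankLambdaParity.lean`).
Net debt 0.

## What (the transport lemma, as a precise comparison statement)

For two congruent curves `E₁, E₂/ℚ` on the SAME ramified ordinary branch at an odd prime `p`
(hypotheses exactly those of `Additive.congruentLambdaShift_of_epw`: `IsRamifiedOrdinaryLine` at
`v ∋ p` on both sides, `E₁[p]` irreducible, a `Γ_ℚ`-equivariant `E₁[p] ≃ E₂[p]` matching the lines,
`Σ₀ ∌ p` outside which both are good) and cyclotomic dual data `D₁, D₂` finitely generated and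
`Λ`-torsion with `μ(D₁.X) = 0`, EPW give `λ(X₁) + Σ_{v∈Σ₀} δ(E₁,v) = λ(X₂) + Σ_{v∈Σ₀} δ(E₂,v)` and
Greenberg's Prop. 3.10 gives `corank Sel_{p^∞}(E_i/ℚ) ≡ λ(X_i) (mod 2)` on each side; hence

  **`(corank Sel_{p^∞}(E₁/ℚ) + Σ_{v∈Σ₀} δ(E₁,v)) ≡ (corank Sel_{p^∞}(E₂/ℚ) + Σ_{v∈Σ₀} δ(E₂,v)) (mod 2)`**

(`selmerCorank_add_sum_delta_mod_two_eq_of_epw`), i.e. the class invariant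
`P_δ(E) := corank_{ℤ_p} Sel_{p^∞}(E/ℚ) + Σ_{v∈Σ₀} δ(E,v) (mod 2)` is CONSTANT along such congruences.
Currencies (§2): with `Ш[p^∞]` finite on both sides the coranks are the Mordell–Weil ranks; with
Gross–Zagier–Kolyvagin (`hGZK`, tree fact `rank_eq_analyticRank_of_analyticRank_le_one`) on
analytic-rank-`≤ 1` rows they are the ANALYTIC ranks: `(r_an(E₁) + Σδ₁) ≡ (r_an(E₂) + Σδ₂) (mod 2)`;
with a partner of FINITE `Sel_{p^∞}` (a descent-certified unit partner) `Σδ₁ ≡ corank(E₂) + Σδ₂`.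
The schema-level core (§1, `selmerCorank_add_mod_two_eq_of_lambdaInvariant_add_eq`) needs no EPW
hypothesis: ANY `ℕ`-identity `λ(X₁) + a = λ(X₂) + b` between cyclotomic torsion dual data of two
curves transports the corank parity — so the same lemma serves X1/X2's good-ordinary
`CongruentLambdaShift` (Greenberg–Vatsal) rows.

## Why (payload (c); ROUTE-2 §II.11)

Route planner 2's PARITY LAW (ROUTE-2.md §II.11, INBOX l.2608): "class invariant
`P := rank + #{ℓ ≠ p : p ∣ c_ℓ} (mod 2)` is constant on same-type congruence classes (R-B + parity) —
0 violations among 1 418 deep-congruent candidate pairs; all 607 parity violators are deep-screen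
FALSE … a free 97 % pre-filter (R2-F7)". This file is the KERNEL form of that law in the tree's
`δ`-currency (`GreenbergVatsal2000.delta = s_ℓ · d_ℓ`, GV Prop. (2.4)): a theorem-backed CONTROL for
the congruence census (cc-eng-2 CONG / cc-eng-3 RELATIONS) in the way C-IMG
(`GaloisImage/SmallImageKuriharaInvariants.lean`) backs KURX — a certified same-branch congruent pair
violating `P_δ` is an ANOMALY line (partner label, branch, or `μ`). What is NOT claimed: the
dictionary between `Σ_{v∈Σ₀} δ(E,v) (mod 2)` and the census's Tamagawa indicator
`#{ℓ : p ∣ c_ℓ(E)}` (ROUTE-2 II.10.9 / II.11.3 (i): per pair, EVIDENCE side); `Λ`-cotorsion and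
`μ(X(E₁)) = 0` (hypotheses, as in the facts); the existence of the ramified ordinary lines (a per-pair
certificate / future kernel lemma, cc-typer-2 INBOX l.2666: "not provable in the tree today"); any
BSD_p statement. Nothing per pair is certified here; no class theorem; nothing booked.

References: M. Emerton, R. Pollack, T. Weston, Invent. Math. 163 (2006), Thms. 3.3.2, 3.3.3 (2),
Lemma 5.1.5 (arXiv:math/0404484 pp. 19, 30) [EmertonPollackWeston2006]; R. Greenberg, LNM 1716
(1999), Prop. 3.10 (held copy chunk p0098 L5 – p0099 L11) [GreenbergLNM1716], §1 p. 53
[Greenberg1999]; R. Greenberg, V. Vatsal, Invent. Math. 142 (2000) §2 Prop. (2.4)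
[GreenbergVatsal2000]; H. Darmon, CBMS 101 (2004) Thm. 3.22 [Darmon2004]; ROUTE-2.md §II.11;
class-closure/N11/TRANSPORT.md (congruence row).
-/

noncomputable section

open scoped Classical

open NumberField IsDedekindDomain Field WeierstrassCurve
  Literature.NumberTheory.GaloisRepresentations
  Literature.NumberTheory.EllipticCurves
  Literature.NumberTheory.EllipticCurves.GreenbergSelmer
  Literature.NumberTheory.EllipticCurves.GreenbergVatsal2000
  Literature.NumberTheory.EllipticCurves.EmertonPollackWeston2006
  Literature.NumberTheory.EllipticCurves.Greenberg1999

namespace Summit.BirchSwinnertonDyer.Rank1Residual.Additive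

variable {W₁ W₂ : WeierstrassCurve ℚ} [W₁.IsElliptic] [W₁.IsGloballyMinimal] [W₂.IsElliptic]
  [W₂.IsGloballyMinimal] {p : ℕ} [Fact p.Prime]

/-! ### §1 Schema-level core: an `ℕ`-identity between `λ`-invariants transports the corank parity -/

variable (W₁ W₂ p) in
/-- **Corank-parity transport from a `λ`-identity** (no EPW hypothesis). Greenberg 1999 Prop. 3.10
(`h310`) at both curves: for the cyclotomic `ℤ_p`-extension with topological generator `γ`, finitely
generated `Λ`-torsion dual data `D₁`, `D₂` and ANY identity `λ(D₁.X) + a = λ(D₂.X) + b` in `ℕ`,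
`(corank Sel_{p^∞}(E₁/ℚ) + a) ≡ (corank Sel_{p^∞}(E₂/ℚ) + b) (mod 2)`, `p` odd.
[cite: GreenbergLNM1716, Prop. 3.10 (chunk p0098 L5 – p0099 L11 of the held copy)] -/
theorem selmerCorank_add_mod_two_eq_of_lambdaInvariant_add_eq
    (h310 : prop310_selmerCorank_mod_two_eq_lambdaInvariant) (hp : p ≠ 2)
    {κ : ZpExtension ℚ p} {γ : absoluteGaloisGroup ℚ} (hκ : κ.IsCyclotomic)
    (hγ : κ.IsTopGenerator γ) (D₁ : W₁.SelmerDualData κ γ) (D₂ : W₂.SelmerDualData κ γ)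
    [Module.Finite (IwasawaAlgebra p) D₁.X] [Module.Finite (IwasawaAlgebra p) D₂.X]
    (hX₁ : D₁.IsTorsion) (hX₂ : D₂.IsTorsion) {a b : ℕ}
    (hlam : lambdaInvariant p D₁.X + a = lambdaInvariant p D₂.X + b) :
    (W₁.selmerCorank p + a) % 2 = (W₂.selmerCorank p + b) % 2 := by
  have e₁ : W₁.selmerCorank p % 2 = lambdaInvariant p D₁.X % 2 := h310 W₁ p hp κ γ hκ hγ D₁ hX₁
  have e₂ : W₂.selmerCorank p % 2 = lambdaInvariant p D₂.X % 2 := h310 W₂ p hp κ γ hκ hγ D₂ hX₂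
  omega

variable (W₁ W₂ p) in
/-- The same, read as the parity of a single sum: `Even (corank(E₁) + corank(E₂) + a + b)`.
[cite: GreenbergLNM1716, Prop. 3.10] -/
theorem even_selmerCorank_add_of_lambdaInvariant_add_eq
    (h310 : prop310_selmerCorank_mod_two_eq_lambdaInvariant) (hp : p ≠ 2)
    {κ : ZpExtension ℚ p} {γ : absoluteGaloisGroup ℚ} (hκ : κ.IsCyclotomic)
    (hγ : κ.IsTopGenerator γ) (D₁ : W₁.SelmerDualData κ γ) (D₂ : W₂.SelmerDualData κ γ)
    [Module.Finite (IwasawaAlgebra p) D₁.X] [Module.Finite (IwasawaAlgebra p) D₂.X]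
    (hX₁ : D₁.IsTorsion) (hX₂ : D₂.IsTorsion) {a b : ℕ}
    (hlam : lambdaInvariant p D₁.X + a = lambdaInvariant p D₂.X + b) :
    Even (W₁.selmerCorank p + W₂.selmerCorank p + a + b) := by
  have e := selmerCorank_add_mod_two_eq_of_lambdaInvariant_add_eq W₁ W₂ p h310 hp hκ hγ D₁ D₂ hX₁
    hX₂ hlam
  rw [Nat.even_iff]
  omega

/-! ### §2 Along an additive congruence on the ramified ordinary branch (EPW 2006) -/

variable (W₁ W₂ p) in
/-- **PARITY TRANSPORT along an additive potentially-ordinary congruence** (EPW 2006 Thm. 3.3.3 (2)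
+ Lemma 5.1.5, `hEPW`; Greenberg 1999 Prop. 3.10, `h310`). Hypotheses as in
`Additive.congruentLambdaShift_of_epw`: `p ≠ 2`, the place `v ∋ p`, ramified ordinary lines `L₁`,
`L₂`, `E₁[p]` irreducible, a line-matching `Γ_ℚ`-equivariant `E₁[p] ≃ E₂[p]`, `Σ₀ ∌ p` outside
which both curves are good; then for the cyclotomic data and finitely generated `Λ`-torsion dual data
`D₁`, `D₂` with `μ(D₁.X) = 0`:
`(corank Sel_{p^∞}(E₁/ℚ) + Σ_{w∈Σ₀} δ(E₁,w)) ≡ (corank Sel_{p^∞}(E₂/ℚ) + Σ_{w∈Σ₀} δ(E₂,w)) (mod 2)` —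
the class invariant `P_δ` is constant along the congruence.
[cite: EmertonPollackWeston2006, Thm. 3.3.3 (2) (arXiv:math/0404484 p. 19) and Lemma 5.1.5 (p. 30)]
[cite: GreenbergLNM1716, Prop. 3.10] -/
theorem selmerCorank_add_sum_delta_mod_two_eq_of_epw
    (hEPW : muLambdaAlg_transfer_of_torsionIso_potOrd)
    (h310 : prop310_selmerCorank_mod_two_eq_lambdaInvariant) (hp : p ≠ 2)
    {v : HeightOneSpectrum (𝓞 ℚ)} (hv : ((p : ℕ) : 𝓞 ℚ) ∈ v.asIdeal)
    {L₁ : LocalDatum ℚ (W₁.geomPrimaryTorsion p) v} {L₂ : LocalDatum ℚ (W₂.geomPrimaryTorsion p) v}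
    (hL₁ : IsRamifiedOrdinaryLine W₁ p L₁) (hL₂ : IsRamifiedOrdinaryLine W₂ p L₂)
    (hirr : W₁.HasIrreducibleModPGaloisRep p)
    (hiso : ∃ e : geomTorsion W₁ (p : ℤ) ≃+ geomTorsion W₂ (p : ℤ),
      (∀ (σ : absoluteGaloisGroup ℚ) (P : geomTorsion W₁ (p : ℤ)), e (σ • P) = σ • e P) ∧
      (∀ P : geomTorsion W₁ (p : ℤ),
        AddSubgroup.inclusion (geomTorsion_le_geomPrimaryTorsion W₁ p) P ∈ L₁.plus ↔
          AddSubgroup.inclusion (geomTorsion_le_geomPrimaryTorsion W₂ p) (e P) ∈ L₂.plus))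
    (S₀ : Finset (HeightOneSpectrum (𝓞 ℚ))) (hS₀ : ∀ w ∈ S₀, ((p : ℕ) : 𝓞 ℚ) ∉ w.asIdeal)
    (hS₁ : ∀ w : HeightOneSpectrum (𝓞 ℚ), w ∉ S₀ → ((p : ℕ) : 𝓞 ℚ) ∉ w.asIdeal →
      W₁.HasGoodReductionAt w)
    (hS₂ : ∀ w : HeightOneSpectrum (𝓞 ℚ), w ∉ S₀ → ((p : ℕ) : 𝓞 ℚ) ∉ w.asIdeal →
      W₂.HasGoodReductionAt w)
    {κ : ZpExtension ℚ p} {γ : absoluteGaloisGroup ℚ} (hκ : κ.IsCyclotomic)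
    (hγ : κ.IsTopGenerator γ) (hγ' : IsCyclotomicVariable p γ)
    (D₁ : W₁.SelmerDualData κ γ) (D₂ : W₂.SelmerDualData κ γ)
    [Module.Finite (IwasawaAlgebra p) D₁.X] [Module.Finite (IwasawaAlgebra p) D₂.X]
    (hX₁ : D₁.IsTorsion) (hX₂ : D₂.IsTorsion) (hμ₁ : D₁.mu = 0) :
    (W₁.selmerCorank p + ∑ w ∈ S₀, delta W₁ p w) % 2 =
      (W₂.selmerCorank p + ∑ w ∈ S₀, delta W₂ p w) % 2 :=
  selmerCorank_add_mod_two_eq_of_lambdaInvariant_add_eq W₁ W₂ p h310 hp hκ hγ D₁ D₂ hX₁ hX₂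
    (hEPW W₁ W₂ p hp v hv L₁ L₂ hL₁ hL₂ hirr hiso S₀ hS₀ hS₁ hS₂ κ γ hκ hγ hγ' D₁ D₂ hX₁ hX₂ hμ₁).2

variable (W₁ W₂ p) in
/-- **Rank currency.** Same hypotheses, plus `Ш(E₁/ℚ)[p^∞]` and `Ш(E₂/ℚ)[p^∞]` finite (corank
identity, Greenberg 1999 §1 — tree theorem `selmerCorank_eq_mordellWeilRank_of_finite_shaPrimary`):
`(rank E₁(ℚ) + Σδ₁) ≡ (rank E₂(ℚ) + Σδ₂) (mod 2)`.
[cite: EmertonPollackWeston2006, Thm. 3.3.3 (2)] [cite: GreenbergLNM1716, Prop. 3.10]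
[cite: Greenberg1999, §1 p. 53 (corank identity)] -/
theorem mordellWeilRank_add_sum_delta_mod_two_eq_of_epw_of_finite_shaPrimary
    (hEPW : muLambdaAlg_transfer_of_torsionIso_potOrd)
    (h310 : prop310_selmerCorank_mod_two_eq_lambdaInvariant) (hp : p ≠ 2)
    {v : HeightOneSpectrum (𝓞 ℚ)} (hv : ((p : ℕ) : 𝓞 ℚ) ∈ v.asIdeal)
    {L₁ : LocalDatum ℚ (W₁.geomPrimaryTorsion p) v} {L₂ : LocalDatum ℚ (W₂.geomPrimaryTorsion p) v}
    (hL₁ : IsRamifiedOrdinaryLine W₁ p L₁) (hL₂ : IsRamifiedOrdinaryLine W₂ p L₂)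
    (hirr : W₁.HasIrreducibleModPGaloisRep p)
    (hiso : ∃ e : geomTorsion W₁ (p : ℤ) ≃+ geomTorsion W₂ (p : ℤ),
      (∀ (σ : absoluteGaloisGroup ℚ) (P : geomTorsion W₁ (p : ℤ)), e (σ • P) = σ • e P) ∧
      (∀ P : geomTorsion W₁ (p : ℤ),
        AddSubgroup.inclusion (geomTorsion_le_geomPrimaryTorsion W₁ p) P ∈ L₁.plus ↔
          AddSubgroup.inclusion (geomTorsion_le_geomPrimaryTorsion W₂ p) (e P) ∈ L₂.plus))
    (S₀ : Finset (HeightOneSpectrum (𝓞 ℚ))) (hS₀ : ∀ w ∈ S₀, ((p : ℕ) : 𝓞 ℚ) ∉ w.asIdeal)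
    (hS₁ : ∀ w : HeightOneSpectrum (𝓞 ℚ), w ∉ S₀ → ((p : ℕ) : 𝓞 ℚ) ∉ w.asIdeal →
      W₁.HasGoodReductionAt w)
    (hS₂ : ∀ w : HeightOneSpectrum (𝓞 ℚ), w ∉ S₀ → ((p : ℕ) : 𝓞 ℚ) ∉ w.asIdeal →
      W₂.HasGoodReductionAt w)
    {κ : ZpExtension ℚ p} {γ : absoluteGaloisGroup ℚ} (hκ : κ.IsCyclotomic)
    (hγ : κ.IsTopGenerator γ) (hγ' : IsCyclotomicVariable p γ)
    (D₁ : W₁.SelmerDualData κ γ) (D₂ : W₂.SelmerDualData κ γ)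
    [Module.Finite (IwasawaAlgebra p) D₁.X] [Module.Finite (IwasawaAlgebra p) D₂.X]
    (hX₁ : D₁.IsTorsion) (hX₂ : D₂.IsTorsion) (hμ₁ : D₁.mu = 0)
    (hsha₁ : Finite (AddCommGroup.primaryComponent W₁.sha p))
    (hsha₂ : Finite (AddCommGroup.primaryComponent W₂.sha p)) :
    (W₁.mordellWeilRank + ∑ w ∈ S₀, delta W₁ p w) % 2 =
      (W₂.mordellWeilRank + ∑ w ∈ S₀, delta W₂ p w) % 2 := by
  rw [← selmerCorank_eq_mordellWeilRank_of_finite_shaPrimary W₁ p hsha₁,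
    ← selmerCorank_eq_mordellWeilRank_of_finite_shaPrimary W₂ p hsha₂]
  exact selmerCorank_add_sum_delta_mod_two_eq_of_epw W₁ W₂ p hEPW h310 hp hv hL₁ hL₂ hirr hiso S₀
    hS₀ hS₁ hS₂ hκ hγ hγ' D₁ D₂ hX₁ hX₂ hμ₁

variable (W₁ W₂ p) in
/-- **Analytic-rank currency** on analytic-rank-`≤ 1` rows (Gross–Zagier–Kolyvagin, tree fact
`rank_eq_analyticRank_of_analyticRank_le_one`, hypothesis `hGZK`): same hypotheses, then
`(r_an(E₁) + Σδ₁) ≡ (r_an(E₂) + Σδ₂) (mod 2)` — the analytic ranks of two congruent curves on the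
same ramified ordinary branch differ in parity exactly by the parity of the `δ`-shift.
[cite: EmertonPollackWeston2006, Thm. 3.3.3 (2)] [cite: GreenbergLNM1716, Prop. 3.10]
[cite: Darmon2004, Thm. 3.22 (Gross–Zagier–Kolyvagin)] -/
theorem analyticRank_add_sum_delta_mod_two_eq_of_epw_of_gzk
    (hEPW : muLambdaAlg_transfer_of_torsionIso_potOrd)
    (h310 : prop310_selmerCorank_mod_two_eq_lambdaInvariant)
    (hGZK : rank_eq_analyticRank_of_analyticRank_le_one) (hp : p ≠ 2)
    {v : HeightOneSpectrum (𝓞 ℚ)} (hv : ((p : ℕ) : 𝓞 ℚ) ∈ v.asIdeal)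
    {L₁ : LocalDatum ℚ (W₁.geomPrimaryTorsion p) v} {L₂ : LocalDatum ℚ (W₂.geomPrimaryTorsion p) v}
    (hL₁ : IsRamifiedOrdinaryLine W₁ p L₁) (hL₂ : IsRamifiedOrdinaryLine W₂ p L₂)
    (hirr : W₁.HasIrreducibleModPGaloisRep p)
    (hiso : ∃ e : geomTorsion W₁ (p : ℤ) ≃+ geomTorsion W₂ (p : ℤ),
      (∀ (σ : absoluteGaloisGroup ℚ) (P : geomTorsion W₁ (p : ℤ)), e (σ • P) = σ • e P) ∧
      (∀ P : geomTorsion W₁ (p : ℤ),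
        AddSubgroup.inclusion (geomTorsion_le_geomPrimaryTorsion W₁ p) P ∈ L₁.plus ↔
          AddSubgroup.inclusion (geomTorsion_le_geomPrimaryTorsion W₂ p) (e P) ∈ L₂.plus))
    (S₀ : Finset (HeightOneSpectrum (𝓞 ℚ))) (hS₀ : ∀ w ∈ S₀, ((p : ℕ) : 𝓞 ℚ) ∉ w.asIdeal)
    (hS₁ : ∀ w : HeightOneSpectrum (𝓞 ℚ), w ∉ S₀ → ((p : ℕ) : 𝓞 ℚ) ∉ w.asIdeal →
      W₁.HasGoodReductionAt w)
    (hS₂ : ∀ w : HeightOneSpectrum (𝓞 ℚ), w ∉ S₀ → ((p : ℕ) : 𝓞 ℚ) ∉ w.asIdeal →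
      W₂.HasGoodReductionAt w)
    {κ : ZpExtension ℚ p} {γ : absoluteGaloisGroup ℚ} (hκ : κ.IsCyclotomic)
    (hγ : κ.IsTopGenerator γ) (hγ' : IsCyclotomicVariable p γ)
    (D₁ : W₁.SelmerDualData κ γ) (D₂ : W₂.SelmerDualData κ γ)
    [Module.Finite (IwasawaAlgebra p) D₁.X] [Module.Finite (IwasawaAlgebra p) D₂.X]
    (hX₁ : D₁.IsTorsion) (hX₂ : D₂.IsTorsion) (hμ₁ : D₁.mu = 0)
    (ha₁ : W₁.analyticRank ≤ 1) (ha₂ : W₂.analyticRank ≤ 1) :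
    (W₁.analyticRank + ∑ w ∈ S₀, delta W₁ p w) % 2 =
      (W₂.analyticRank + ∑ w ∈ S₀, delta W₂ p w) % 2 := by
  obtain ⟨hrk₁, hfin₁⟩ := hGZK W₁ ha₁
  obtain ⟨hrk₂, hfin₂⟩ := hGZK W₂ ha₂
  haveI : Finite W₁.sha := hfin₁
  haveI : Finite W₂.sha := hfin₂
  have hsha₁ : Finite (AddCommGroup.primaryComponent W₁.sha p) := inferInstance
  have hsha₂ : Finite (AddCommGroup.primaryComponent W₂.sha p) := inferInstance
  rw [← hrk₁, ← hrk₂]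
  exact mordellWeilRank_add_sum_delta_mod_two_eq_of_epw_of_finite_shaPrimary W₁ W₂ p hEPW h310 hp
    hv hL₁ hL₂ hirr hiso S₀ hS₀ hS₁ hS₂ hκ hγ hγ' D₁ D₂ hX₁ hX₂ hμ₁ hsha₁ hsha₂

variable (W₁ W₂ p) in
/-- **Unit-partner currency.** Same hypotheses with a partner `E₁` of FINITE `Sel_{p^∞}(E₁/ℚ)`
(a descent-certified rank-`0` partner with `Ш(E₁)[p] = 0`; corank `0` by
`WeierstrassCurve.selmerCorank_eq_zero_of_finite`): `Σδ₁ ≡ corank Sel_{p^∞}(E₂/ℚ) + Σδ₂ (mod 2)` —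
the parity of `corank Sel_{p^∞}(E₂/ℚ)` is READ OFF the local terms.
[cite: EmertonPollackWeston2006, Thm. 3.3.3 (2)] [cite: GreenbergLNM1716, Prop. 3.10] -/
theorem sum_delta_mod_two_eq_of_epw_of_finite_selmer
    (hEPW : muLambdaAlg_transfer_of_torsionIso_potOrd)
    (h310 : prop310_selmerCorank_mod_two_eq_lambdaInvariant) (hp : p ≠ 2)
    {v : HeightOneSpectrum (𝓞 ℚ)} (hv : ((p : ℕ) : 𝓞 ℚ) ∈ v.asIdeal)
    {L₁ : LocalDatum ℚ (W₁.geomPrimaryTorsion p) v} {L₂ : LocalDatum ℚ (W₂.geomPrimaryTorsion p) v}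
    (hL₁ : IsRamifiedOrdinaryLine W₁ p L₁) (hL₂ : IsRamifiedOrdinaryLine W₂ p L₂)
    (hirr : W₁.HasIrreducibleModPGaloisRep p)
    (hiso : ∃ e : geomTorsion W₁ (p : ℤ) ≃+ geomTorsion W₂ (p : ℤ),
      (∀ (σ : absoluteGaloisGroup ℚ) (P : geomTorsion W₁ (p : ℤ)), e (σ • P) = σ • e P) ∧
      (∀ P : geomTorsion W₁ (p : ℤ),
        AddSubgroup.inclusion (geomTorsion_le_geomPrimaryTorsion W₁ p) P ∈ L₁.plus ↔
          AddSubgroup.inclusion (geomTorsion_le_geomPrimaryTorsion W₂ p) (e P) ∈ L₂.plus))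
    (S₀ : Finset (HeightOneSpectrum (𝓞 ℚ))) (hS₀ : ∀ w ∈ S₀, ((p : ℕ) : 𝓞 ℚ) ∉ w.asIdeal)
    (hS₁ : ∀ w : HeightOneSpectrum (𝓞 ℚ), w ∉ S₀ → ((p : ℕ) : 𝓞 ℚ) ∉ w.asIdeal →
      W₁.HasGoodReductionAt w)
    (hS₂ : ∀ w : HeightOneSpectrum (𝓞 ℚ), w ∉ S₀ → ((p : ℕ) : 𝓞 ℚ) ∉ w.asIdeal →
      W₂.HasGoodReductionAt w)
    {κ : ZpExtension ℚ p} {γ : absoluteGaloisGroup ℚ} (hκ : κ.IsCyclotomic)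
    (hγ : κ.IsTopGenerator γ) (hγ' : IsCyclotomicVariable p γ)
    (D₁ : W₁.SelmerDualData κ γ) (D₂ : W₂.SelmerDualData κ γ)
    [Module.Finite (IwasawaAlgebra p) D₁.X] [Module.Finite (IwasawaAlgebra p) D₂.X]
    (hX₁ : D₁.IsTorsion) (hX₂ : D₂.IsTorsion) (hμ₁ : D₁.mu = 0)
    (hSel₁ : Finite (W₁.selmerGroupPInfty p)) :
    (∑ w ∈ S₀, delta W₁ p w) % 2 = (W₂.selmerCorank p + ∑ w ∈ S₀, delta W₂ p w) % 2 := by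
  have h := selmerCorank_add_sum_delta_mod_two_eq_of_epw W₁ W₂ p hEPW h310 hp hv hL₁ hL₂ hirr hiso
    S₀ hS₀ hS₁ hS₂ hκ hγ hγ' D₁ D₂ hX₁ hX₂ hμ₁
  haveI := hSel₁
  rwa [W₁.selmerCorank_eq_zero_of_finite p, zero_add] at h

end Summit.BirchSwinnertonDyer.Rank1Residual.Additive

end
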